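import Literature.Analysis.FluidPDE.EnstrophySplittingDissipation
import Literature.Analysis.FluidPDE.NSEnstrophyPersistence
import HarnessLib

/-!
# The enstrophy a priori bound with lifespan `‖∇u₀‖⁴ T ≤ c ν³` for classical solutions
# (Robinson–Rodrigo–Sadowski 2016, (6.6)–(6.10); discharge of `leray_enstrophy_apriori`)

Analysis/FluidPDE proof file (no named facts). For a classical solution `(u, p)` of the unforced
Navier–Stokes system on a closed slab `[0, T] × ℝ³` in the `L²`-Sobolev class of Tao's smooth
`H¹` theory (`u, ∂ₜu, p ∈ L^∞_t H^k_x`, the class of `serrin_enstrophy_bound` and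
`tao2011_smooth_local_existence`) we prove the cubic enstrophy inequality **with dissipation**

  `‖∇u(b)‖²₂ + ν ∫₀ᵇ ‖Δu‖²₂ ≤ ‖∇u(0)‖²₂ + κ ν⁻³ ∫₀ᵇ ‖∇u‖⁶₂`      (RRS (6.7) integrated),

and deduce by a continuity (bootstrap) argument the uniform bounds

  `∫|∇u(0)|² ≤ A`, `A² T ≤ c ν³`  ⟹  `∫|∇u(t)|² ≤ 2A` on `[0, T]` and `ν ∫₀ᵀ∫ ‖D²u‖² ≤ K A`

with absolute constants `c, K` (RRS (6.9)–(6.10), Cor. 6.9), i.e. the statement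
`LerayEnstrophyAPrioriWith c K` vendored in `TaoH1APriori.lean`
(`leray_enstrophy_apriori_with`).

## The argument

1. **Dissipative slice inequality by viscosity splitting** (`exists_slice_dissipative`). The tree's
   Serrin production bound `integral_sum_inner_fderiv_le_of_momentum_of_eLpNorm`
   (`SerrinEnstrophyGronwall.lean`; at `r = 6`: `∫ Σᵢ⟪∂ᵢv, ∂ᵢW⟫ ≤ C ν⁻³ ‖v‖⁴_{L⁶} ∫|∇v|²` whenever
   `W + (v·∇)v = νΔv − ∇q`) spends the whole dissipation. Applying it with viscosity `ν/2` to
   `W' = W − (ν/2)Δv` (which satisfies `W' + (v·∇)v = (ν/2)Δv − ∇q`) and adding back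
   `∫ Σᵢ⟪∂ᵢv, ∂ᵢ((ν/2)Δv)⟫ = −(ν/2)‖Δv‖²₂` (Green's identity) gives
   `∫ Σᵢ⟪∂ᵢv, ∂ᵢW⟫ ≤ −(ν/2)‖Δv‖²₂ + 8C ν⁻³ ‖v‖⁴_{L⁶} ∫|∇v|²`.
2. **Slab** (`enstrophy_dissipation_ineq`): with the Sobolev inequality `‖v‖_{L⁶} ≤ K_S ‖Dv‖_{L²}`
   (`eLpNorm_six_le_eLpNorm_fderiv_two`) the production is `≤ κ ν⁻³ (∫|∇u|²)³`; the enstrophy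
   balance `G(b) = G(0) + ∫₀ᵇ 2Σᵢ∫⟪∂ᵢu, ∂ᵢ∂ₜu⟫` (`IsSmoothSpaceTimeOn.enstrophy_balance`) then yields
   `G(b) ≤ G(0) + κν⁻³∫₀ᵇ G³` and `ν ∫₀ᵀ ‖Δu‖²₂ ≤ G(0) + κν⁻³ ∫₀ᵀ G³` (lower integrals, no
   measurability in time needed for the dissipation).
3. **Bootstrap** (`leray_enstrophy_apriori_with`): under `G ≤ 2A` on `[0, t]` the cubic
   inequality is linear with rate `4κν⁻³A²`, and the tree's continuity method
   `bootstrap_gronwall_integral` (`TaoEnstrophyContinuity.lean`) closes as soon as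
   `exp(4κν⁻³A²T) A < 2A`, i.e. for `8κ A² T ≤ ν³`; the dissipation bound follows, and
   `∫‖D²v‖² ≤ 27 Σᵢⱼ‖∂ᵢ∂ⱼv‖²₂ = 27 ‖Δv‖²₂` (coordinate tensors of `CoordDerivatives.lean` and the
   Hessian–Laplacian identity of `EnstrophySplitting.lean`) converts `Δu` into `D²u`.

## Mathlib / tree search

No Navier–Stokes material in Mathlib. Tree: `serrin_enstrophy_bound` /
`integral_sum_inner_fderiv_le_of_momentum_of_eLpNorm` (`SerrinEnstrophyGronwall.lean`, the Serrin
production bound without dissipation, reused here at `r = 6`); `EnstrophySplittingDissipation.lean`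
(the same viscosity-splitting device for von Wahl's `L³`-small plus bounded class, linear
Grönwall — a different inequality; its `L²` helpers are reused); `bootstrap_gronwall_integral`
(`TaoEnstrophyContinuity.lean`); `levelSq`, `lintegral_sq_norm_iteratedFDeriv_le`
(`CoordDerivatives.lean`, `NSEnstrophyPersistence.lean`);
`sum_sum_integral_sq_norm_fderiv_fderiv_eq_integral_sq_norm_laplacian` (`EnstrophySplitting.lean`).
`lean search 'enstrophy_apriori' / 'cubic' / 'lifespan'`: nothing with the cubic nonlinearity or
the `H¹` lifespan.

## References

* J. C. Robinson, J. L. Rodrigo, W. Sadowski, *The Three-Dimensional Navier–Stokes Equations*,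
  CUP 2016, proof of Thm. 6.8, (6.6)–(6.10), Cor. 6.9 (PDF pp. 103–105). [RobinsonRodrigoSadowski2016]
* T. Tao, Anal. PDE 6 (2013) = arXiv:1108.1165, Thm. 5.4 (ii) (the class and the bound
  `‖u‖_{X¹} ≲ ‖u₀‖_{H¹}`). [Tao2011]
* P. G. Lemarié-Rieusset, *The Navier–Stokes Problem in the 21st Century*, CRC 2016, (11.9)
  (the enstrophy production identity). [LemarieRieusset2016]
-/

noncomputable section

open MeasureTheory Set Function Filter Topology InnerProductSpace
open scoped ENNReal NNReal ContDiff RealInnerProductSpace Laplacian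

namespace Literature.Analysis.FluidPDE

/-! ### `L²` bookkeeping -/

section L2

/-- `∫ ‖f + g‖² < ∞` from `∫ ‖f‖² < ∞` and `∫ ‖g‖² < ∞` (measurable `f`, `g`). [folklore] -/
theorem lintegral_enorm_sq_add_lt_top {α : Type*} [MeasurableSpace α] {μ : Measure α}
    {G : Type*} [NormedAddCommGroup G] {f g : α → G} (hf : AEStronglyMeasurable f μ) (hg : AEStronglyMeasurable g μ)
    (hf2 : ∫⁻ x, ‖f x‖ₑ ^ 2 ∂μ < ⊤) (hg2 : ∫⁻ x, ‖g x‖ₑ ^ 2 ∂μ < ⊤) :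
    ∫⁻ x, ‖f x + g x‖ₑ ^ 2 ∂μ < ⊤ := by
  have hfm : MemLp f 2 μ := ⟨hf, eLpNorm_two_lt_top_of_lintegral_enorm_sq_lt_top hf2⟩
  have hgm : MemLp g 2 μ := ⟨hg, eLpNorm_two_lt_top_of_lintegral_enorm_sq_lt_top hg2⟩
  have h := (hfm.add hgm).eLpNorm_lt_top
  rw [lintegral_enorm_sq_eq_eLpNorm_two_sq]
  exact ENNReal.pow_lt_top h

end L2

/-! ### The dissipative enstrophy production bound at a fixed time -/

section Slice

/-- **The enstrophy production bound keeping half of the dissipation** (Robinson–Rodrigo–Sadowski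
2016, (6.6)–(6.7): `½ d/dt‖∇u‖² + ‖Au‖² = −⟨(u·∇)u, Au⟩ ≤ c‖∇u‖^{3/2}‖Au‖^{3/2}`, in the
`L⁶ × L³ × L²` form of the whole space). There is an absolute constant `C ≥ 0` such that: if
`v : ℝ³ → ℝ³` is `C³`, divergence free and bounded (for integrability only), `W : ℝ³ → ℝ³` and
`q : ℝ³ → ℝ` are `C¹` with the momentum equation `W + (v·∇)v = νΔv − ∇q` (`ν > 0`), and
`Dv, D²v, D³v, W, DW, q, Dq ∈ L²`, `v ∈ L⁶`, then
`∫ Σᵢ ⟪∂ᵢv, ∂ᵢW⟫ ≤ −(ν/2) ∫ ‖Δv‖² + C ν⁻³ ‖v‖⁴_{L⁶} ∫ |∇v|²`.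
Proof: the tree's `integral_sum_inner_fderiv_le_of_momentum_of_eLpNorm` (`r = 6`, viscosity
`ν/2`) applied to `W' = W − (ν/2)Δv`, plus Green's identity `∫ Σᵢ⟪∂ᵢv, ∂ᵢΔv⟫ = −∫‖Δv‖²`
(`integral_sum_inner_fderiv_fderiv_eq_neg_integral_inner_laplacian`). [cite: RobinsonRodrigoSadowski2016, Thm. 6.8 (proof, (6.6)-(6.7))] -/
theorem exists_slice_dissipative :
    ∃ C : ℝ, 0 ≤ C ∧ ∀ ⦃ν : ℝ⦄ (_ : 0 < ν)
      ⦃v W : EuclideanSpace ℝ (Fin 3) → EuclideanSpace ℝ (Fin 3)⦄ ⦃q : EuclideanSpace ℝ (Fin 3) → ℝ⦄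
      (_ : ContDiff ℝ 3 v) (_ : ContDiff ℝ 1 W) (_ : ContDiff ℝ 1 q)
      (_ : ∀ x, W x + FluidPDE.convect v v x = ν • (Δ v) x - gradient q x)
      (_ : VectorCalculus.IsDivFree v) ⦃B : ℝ⦄ (_ : ∀ x, ‖v x‖ ≤ B)
      (_ : eLpNorm v 6 volume < ⊤)
      (_ : ∫⁻ x, ‖iteratedFDeriv ℝ 1 v x‖ₑ ^ 2 < ⊤) (_ : ∫⁻ x, ‖iteratedFDeriv ℝ 2 v x‖ₑ ^ 2 < ⊤)
      (_ : ∫⁻ x, ‖iteratedFDeriv ℝ 3 v x‖ₑ ^ 2 < ⊤)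
      (_ : ∫⁻ x, ‖W x‖ₑ ^ 2 < ⊤) (_ : ∫⁻ x, ‖iteratedFDeriv ℝ 1 W x‖ₑ ^ 2 < ⊤)
      (_ : ∫⁻ x, ‖q x‖ₑ ^ 2 < ⊤) (_ : ∫⁻ x, ‖iteratedFDeriv ℝ 1 q x‖ₑ ^ 2 < ⊤),
      ∫ x, ∑ i, ⟪fderiv ℝ v x (EuclideanSpace.basisFun (Fin 3) ℝ i),
          fderiv ℝ W x (EuclideanSpace.basisFun (Fin 3) ℝ i)⟫ ≤
        -(ν / 2) * (∫ x, ‖(Δ v) x‖ ^ 2) +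
          C * (ν ^ 3)⁻¹ * (eLpNorm v 6 volume).toReal ^ 4 *
            ∫ x, FluidPDE.frobeniusNormSq (fderiv ℝ v x) := by
  set K : ℝ≥0 := SNormLESNormFDerivOfEqConst (EuclideanSpace ℝ (Fin 3))
    (volume : Measure (EuclideanSpace ℝ (Fin 3))) 2 with hK
  set θ : ℝ := 1 / 2 with hθdef
  set C₀ : ℝ := θ * (2 * (1 - θ)) ^ ((1 - θ) / θ) * 2 ^ (-(1 / θ)) * (K : ℝ) ^ (2 * (1 - θ) / θ)
    with hC₀
  have hθ1 : 0 ≤ 1 - θ := by norm_num [hθdef]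
  have hC₀0 : 0 ≤ C₀ := by positivity
  refine ⟨8 * C₀, by positivity, ?_⟩
  intro ν hν v W q hv hW hq hmom hdiv B hB hv6 hv1 hv2 hv3 hW0 hW1 hq0 hq1
  set e := EuclideanSpace.basisFun (Fin 3) ℝ with he
  have hν2 : 0 < ν / 2 := half_pos hν
  have hv2' : ContDiff ℝ 2 v := hv.of_le (by norm_num)
  have hΔ1 : ContDiff ℝ 1 (Δ v) := contDiff_one_laplacian_of_contDiff_three hv
  -- the modified time derivative `W' = W - (ν/2) Δv`
  set W' : EuclideanSpace ℝ (Fin 3) → EuclideanSpace ℝ (Fin 3) :=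
    fun x => W x + (-(ν / 2)) • (Δ v) x with hW'def
  have hW' : ContDiff ℝ 1 W' := hW.add (hΔ1.const_smul (-(ν / 2)))
  have hmom' : ∀ x, W' x + FluidPDE.convect v v x = (ν / 2) • (Δ v) x - gradient q x := by
    intro x
    have h := hmom x
    have e2 : ν • (Δ v) x = (ν / 2) • (Δ v) x + (ν / 2) • (Δ v) x := by
      rw [← add_smul]; congr 1; ring
    have h' : W x = ν • (Δ v) x - gradient q x - FluidPDE.convect v v x := eq_sub_of_add_eq h
    simp only [hW'def]
    rw [h', e2, neg_smul]
    abel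
  -- continuity and pointwise bounds
  have cW : Continuous W := hW.continuous
  have cΔ : Continuous (Δ v) := hΔ1.continuous
  have cD2 : Continuous fun x => iteratedFDeriv ℝ 2 v x := hv.continuous_iteratedFDeriv (by norm_num)
  have cD3 : Continuous fun x => iteratedFDeriv ℝ 3 v x := hv.continuous_iteratedFDeriv (by norm_num)
  have c3D2 : Continuous fun x => (3 : ℝ) • iteratedFDeriv ℝ 2 v x := cD2.const_smul (3 : ℝ)
  have c3D3 : Continuous fun x => (3 : ℝ) • iteratedFDeriv ℝ 3 v x := cD3.const_smul (3 : ℝ)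
  have n_Δ : ∀ x, ‖(Δ v) x‖ ≤ ‖(3 : ℝ) • iteratedFDeriv ℝ 2 v x‖ := fun x => by
    rw [norm_smul, Real.norm_of_nonneg (by norm_num : (0 : ℝ) ≤ 3)]
    exact norm_laplacian_le_three_mul_norm_iteratedFDeriv_two hv2' x
  have n_dΔ : ∀ i x, ‖fderiv ℝ (Δ v) x (e i)‖ ≤ ‖(3 : ℝ) • iteratedFDeriv ℝ 3 v x‖ := fun i x => by
    rw [norm_smul, Real.norm_of_nonneg (by norm_num : (0 : ℝ) ≤ 3),
      fderiv_laplacian_apply_of_contDiff_three hv x (e i)]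
    exact (norm_laplacian_le_three_mul_norm_iteratedFDeriv_two
      ((hv.fderiv_right (m := 2) (by norm_num)).clm_apply contDiff_const) x).trans
      (mul_le_mul_of_nonneg_left (norm_iteratedFDeriv_fderiv_apply_basisFun_le hv 2 (by norm_num) x i)
        (by norm_num))
  have l2smul : ∀ {k : ℕ}, ∫⁻ x, ‖iteratedFDeriv ℝ k v x‖ₑ ^ 2 < ⊤ →
      ∫⁻ x, ‖(3 : ℝ) • iteratedFDeriv ℝ k v x‖ₑ ^ 2 < ⊤ := fun hk =>
    lintegral_enorm_sq_const_smul_lt_top 3 hk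
  have l2Δ : ∫⁻ x, ‖(Δ v) x‖ₑ ^ 2 < ⊤ := lintegral_enorm_sq_lt_top_of_norm_le n_Δ (l2smul hv2)
  -- `D(Δv) ∈ L²`: `‖D(Δv)(x)‖² ≤ Σᵢ ‖∂ᵢΔv(x)‖² ≤ 3 ‖3 D³v(x)‖²`
  have l2DΔ : ∫⁻ x, ‖fderiv ℝ (Δ v) x‖ₑ ^ 2 < ⊤ := by
    have hpt : ∀ x, ‖fderiv ℝ (Δ v) x‖ₑ ^ 2 ≤ 3 * ‖(3 : ℝ) • iteratedFDeriv ℝ 3 v x‖ₑ ^ 2 := by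
      intro x
      have h1 : ‖fderiv ℝ (Δ v) x‖ ^ 2 ≤ ∑ i, ‖fderiv ℝ (Δ v) x (e i)‖ ^ 2 :=
        FluidPDE.sq_opNorm_le_sum_sq_norm_apply e _
      have h2 : ∑ i, ‖fderiv ℝ (Δ v) x (e i)‖ ^ 2 ≤ 3 * ‖(3 : ℝ) • iteratedFDeriv ℝ 3 v x‖ ^ 2 :=
        calc ∑ i, ‖fderiv ℝ (Δ v) x (e i)‖ ^ 2 ≤ ∑ _i : Fin 3, ‖(3 : ℝ) • iteratedFDeriv ℝ 3 v x‖ ^ 2 :=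
              Finset.sum_le_sum fun i _ => pow_le_pow_left₀ (norm_nonneg _) (n_dΔ i x) 2
          _ = 3 * ‖(3 : ℝ) • iteratedFDeriv ℝ 3 v x‖ ^ 2 := by simp
      have h3 := h1.trans h2
      calc ‖fderiv ℝ (Δ v) x‖ₑ ^ 2 = ENNReal.ofReal (‖fderiv ℝ (Δ v) x‖ ^ 2) := by
            rw [← ofReal_norm, ENNReal.ofReal_pow (norm_nonneg _)]
        _ ≤ ENNReal.ofReal (3 * ‖(3 : ℝ) • iteratedFDeriv ℝ 3 v x‖ ^ 2) := ENNReal.ofReal_le_ofReal h3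
        _ = 3 * ‖(3 : ℝ) • iteratedFDeriv ℝ 3 v x‖ₑ ^ 2 := by
            rw [ENNReal.ofReal_mul (by norm_num), ← ofReal_norm, ENNReal.ofReal_pow (norm_nonneg _),
              ENNReal.ofReal_ofNat]
    calc ∫⁻ x, ‖fderiv ℝ (Δ v) x‖ₑ ^ 2 ≤ ∫⁻ x, 3 * ‖(3 : ℝ) • iteratedFDeriv ℝ 3 v x‖ₑ ^ 2 :=
          lintegral_mono hpt
      _ = 3 * ∫⁻ x, ‖(3 : ℝ) • iteratedFDeriv ℝ 3 v x‖ₑ ^ 2 := lintegral_const_mul' _ _ (by norm_num)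
      _ < ⊤ := ENNReal.mul_lt_top (by norm_num) (l2smul hv3)
  -- `W', DW' ∈ L²`
  have hW'0 : ∫⁻ x, ‖W' x‖ₑ ^ 2 < ⊤ := by
    have cg : Continuous (fun x => (-(ν / 2)) • (Δ v) x) := cΔ.const_smul (-(ν / 2))
    have hg2 : ∫⁻ x, ‖(-(ν / 2)) • (Δ v) x‖ₑ ^ 2 < ⊤ := lintegral_enorm_sq_const_smul_lt_top (-(ν / 2)) l2Δ
    have h := lintegral_enorm_sq_add_lt_top cW.aestronglyMeasurable cg.aestronglyMeasurable hW0 hg2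
    simpa only [hW'def] using h
  have hDW : ∫⁻ x, ‖fderiv ℝ W x‖ₑ ^ 2 < ⊤ :=
    lintegral_enorm_sq_lt_top_of_norm_le (fun x => by
      rw [← norm_iteratedFDeriv_fderiv, norm_iteratedFDeriv_zero]) hW1
  have hdW : Differentiable ℝ W := hW.differentiable one_ne_zero
  have hdΔ : Differentiable ℝ (Δ v) := hΔ1.differentiable one_ne_zero
  have hfd : ∀ x, fderiv ℝ W' x = fderiv ℝ W x + (-(ν / 2)) • fderiv ℝ (Δ v) x := fun x =>
    ((hdW x).hasFDerivAt.add (((hdΔ x).hasFDerivAt).const_smul (-(ν / 2)))).fderiv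
  have hW'1 : ∫⁻ x, ‖iteratedFDeriv ℝ 1 W' x‖ₑ ^ 2 < ⊤ := by
    -- work with the real-valued majorant `‖DW‖ + (ν/2)‖DΔv‖` (cheap instances)
    have cDW : Continuous (fderiv ℝ W) := hW.continuous_fderiv one_ne_zero
    have cDΔ : Continuous (fderiv ℝ (Δ v)) := hΔ1.continuous_fderiv one_ne_zero
    have ca : Continuous fun x => ‖fderiv ℝ W x‖ := cDW.norm
    have cb : Continuous fun x => (ν / 2) * ‖fderiv ℝ (Δ v) x‖ := continuous_const.mul cDΔ.norm
    have ha2 : ∫⁻ x, ‖(‖fderiv ℝ W x‖)‖ₑ ^ 2 < ⊤ :=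
      lintegral_enorm_sq_lt_top_of_norm_le (fun x => by rw [norm_norm]) hDW
    have hb2 : ∫⁻ x, ‖(ν / 2) * ‖fderiv ℝ (Δ v) x‖‖ₑ ^ 2 < ⊤ := by
      have h := lintegral_enorm_sq_const_smul_lt_top (ν / 2) (lintegral_enorm_sq_lt_top_of_norm_le
        (fun x => by rw [norm_norm]) l2DΔ : ∫⁻ x, ‖(‖fderiv ℝ (Δ v) x‖)‖ₑ ^ 2 < ⊤)
      simpa only [smul_eq_mul] using h
    have h := lintegral_enorm_sq_add_lt_top ca.aestronglyMeasurable cb.aestronglyMeasurable ha2 hb2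
    refine lintegral_enorm_sq_lt_top_of_norm_le (fun x => ?_) h
    rw [← norm_iteratedFDeriv_fderiv, norm_iteratedFDeriv_zero, hfd x,
      Real.norm_of_nonneg (by positivity)]
    refine (norm_add_le _ _).trans ?_
    rw [norm_smul, Real.norm_of_nonpos (by linarith), neg_neg]
  -- continuity / finiteness of the first-order slices
  have cDv : Continuous (fderiv ℝ v) := hv.continuous_fderiv (by norm_num)
  have cdiv : ∀ i, Continuous fun x => fderiv ℝ v x (e i) := fun i => cDv.clm_apply continuous_const
  have cDW : Continuous (fderiv ℝ W) := hW.continuous_fderiv one_ne_zero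
  have cdiW : ∀ i, Continuous fun x => fderiv ℝ W x (e i) := fun i => cDW.clm_apply continuous_const
  have cDΔ : Continuous (fderiv ℝ (Δ v)) := hΔ1.continuous_fderiv one_ne_zero
  have cdiΔ : ∀ i, Continuous fun x => fderiv ℝ (Δ v) x (e i) := fun i => cDΔ.clm_apply continuous_const
  have cddv : ∀ i, Continuous fun x => fderiv ℝ (fun y => fderiv ℝ v y (e i)) x (e i) := fun i =>
    ((((hv.fderiv_right (m := 2) (by norm_num)).clm_apply contDiff_const).continuous_fderiv
      (by norm_num)).clm_apply continuous_const)
  have he1 : ∀ i, ‖e i‖ = 1 := fun i => by simp [he]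
  have hDv_eq : ∀ x, ‖fderiv ℝ v x‖ = ‖iteratedFDeriv ℝ 1 v x‖ := fun x => by
    rw [← norm_iteratedFDeriv_fderiv, norm_iteratedFDeriv_zero]
  have l2Dv : ∫⁻ x, ‖fderiv ℝ v x‖ₑ ^ 2 < ⊤ :=
    lintegral_enorm_sq_lt_top_of_norm_le (fun x => (hDv_eq x).le) hv1
  have l2div : ∀ i, ∫⁻ x, ‖fderiv ℝ v x (e i)‖ₑ ^ 2 < ⊤ := fun i =>
    lintegral_enorm_sq_lt_top_of_norm_le (fun x => by
      simpa [he1] using (fderiv ℝ v x).le_opNorm (e i)) l2Dv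
  have l2diW : ∀ i, ∫⁻ x, ‖fderiv ℝ W x (e i)‖ₑ ^ 2 < ⊤ := fun i =>
    lintegral_enorm_sq_lt_top_of_norm_le (fun x => norm_fderiv_apply_basisFun_le W x i) hW1
  have l2diΔ : ∀ i, ∫⁻ x, ‖fderiv ℝ (Δ v) x (e i)‖ₑ ^ 2 < ⊤ := fun i =>
    lintegral_enorm_sq_lt_top_of_norm_le (fun x => n_dΔ i x) (l2smul hv3)
  have l2ddv : ∀ i, ∫⁻ x, ‖fderiv ℝ (fun y => fderiv ℝ v y (e i)) x (e i)‖ₑ ^ 2 < ⊤ := fun i =>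
    lintegral_enorm_sq_lt_top_of_norm_le (fun x => norm_fderiv_fderiv_apply_basisFun_le hv2' x i) hv2
  -- integrability of the pairings
  have i2W : ∀ i, Integrable (fun x => ⟪fderiv ℝ v x (e i), fderiv ℝ W x (e i)⟫) volume := fun i =>
    integrable_of_norm_le_mul_of_lintegral_sq ((cdiv i).inner (cdiW i)).aestronglyMeasurable
      (cdiv i) (cdiW i) (l2div i) (l2diW i) fun x => norm_inner_le_norm _ _
  have i2Δ : ∀ i, Integrable (fun x => ⟪fderiv ℝ v x (e i), fderiv ℝ (Δ v) x (e i)⟫) volume :=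
    fun i => integrable_of_norm_le_mul_of_lintegral_sq ((cdiv i).inner (cdiΔ i)).aestronglyMeasurable
      (cdiv i) (cdiΔ i) (l2div i) (l2diΔ i) fun x => norm_inner_le_norm _ _
  have i_b1 : ∀ i, Integrable (fun x => ⟪fderiv ℝ (fun y => fderiv ℝ v y (e i)) x (e i), (Δ v) x⟫)
      volume := fun i =>
    integrable_of_norm_le_mul_of_lintegral_sq ((cddv i).inner cΔ).aestronglyMeasurable
      (cddv i) cΔ (l2ddv i) l2Δ fun x => norm_inner_le_norm _ _
  have i_b3 : ∀ i, Integrable (fun x => ⟪fderiv ℝ v x (e i), (Δ v) x⟫) volume := fun i =>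
    integrable_of_norm_le_mul_of_lintegral_sq ((cdiv i).inner cΔ).aestronglyMeasurable
      (cdiv i) cΔ (l2div i) l2Δ fun x => norm_inner_le_norm _ _
  -- the Serrin slice bound with viscosity `ν/2` for `W'` (`r = 6`, `θ = 1/2`)
  have hθ : θ = 1 - (3 / (6 : ℝ≥0∞)).toReal := by
    rw [hθdef, ENNReal.toReal_div, ENNReal.toReal_ofNat, ENNReal.toReal_ofNat]; norm_num
  have hsl := integral_sum_inner_fderiv_le_of_momentum_of_eLpNorm hν2 hv hW' hq hmom' hdiv hB
    (r := 6) (by norm_num) hv6 hθ hv1 hv2 hv3 hW'0 hW'1 hq0 hq1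
  rw [← hK, ← hC₀] at hsl
  -- the exponents at `θ = 1/2`
  set N : ℝ := (eLpNorm v 6 volume).toReal with hNdef
  have hN0 : 0 ≤ N := ENNReal.toReal_nonneg
  have hpow1 : (ν / 2) ^ ((1 : ℝ) - 2 / θ) = 8 * (ν ^ 3)⁻¹ := by
    have hexp : (1 : ℝ) - 2 / θ = -((3 : ℕ) : ℝ) := by rw [hθdef]; norm_num
    rw [hexp, Real.rpow_neg hν2.le, Real.rpow_natCast]
    field_simp
    ring
  have hpow2 : N ^ ((2 : ℝ) / θ) = N ^ 4 := by
    have hexp : (2 : ℝ) / θ = ((4 : ℕ) : ℝ) := by rw [hθdef]; norm_num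
    rw [hexp, Real.rpow_natCast]
  rw [hpow1, hpow2] at hsl
  -- linearity in `W'` and Green's identity
  have hpt : ∀ x, ∑ i, ⟪fderiv ℝ v x (e i), fderiv ℝ W' x (e i)⟫ =
      ∑ i, ⟪fderiv ℝ v x (e i), fderiv ℝ W x (e i)⟫ +
        (-(ν / 2)) * ∑ i, ⟪fderiv ℝ v x (e i), fderiv ℝ (Δ v) x (e i)⟫ := by
    intro x
    rw [hfd x, Finset.mul_sum, ← Finset.sum_add_distrib]
    refine Finset.sum_congr rfl fun i _ => ?_
    rw [add_apply, FunLike.coe_smul, Pi.smul_apply, inner_add_right, real_inner_smul_right]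
  have hlin : ∫ x, ∑ i, ⟪fderiv ℝ v x (e i), fderiv ℝ W' x (e i)⟫ =
      (∫ x, ∑ i, ⟪fderiv ℝ v x (e i), fderiv ℝ W x (e i)⟫) +
        (-(ν / 2)) * ∫ x, ∑ i, ⟪fderiv ℝ v x (e i), fderiv ℝ (Δ v) x (e i)⟫ := by
    rw [← integral_const_mul, ← integral_add (integrable_finsetSum _ fun i _ => i2W i)
      ((integrable_finsetSum _ fun i _ => i2Δ i).const_mul _)]
    exact integral_congr_ae (Eventually.of_forall hpt)
  have hgreen : ∫ x, ∑ i, ⟪fderiv ℝ v x (e i), fderiv ℝ (Δ v) x (e i)⟫ = - ∫ x, ‖(Δ v) x‖ ^ 2 := by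
    rw [integral_sum_inner_fderiv_fderiv_eq_neg_integral_inner_laplacian hv2' hΔ1 i_b1 i2Δ i_b3]
    congr 1
    exact integral_congr_ae (Eventually.of_forall fun x => real_inner_self_eq_norm_sq _)
  rw [hgreen] at hlin
  -- conclude
  have hG0 : 0 ≤ ∫ x, FluidPDE.frobeniusNormSq (fderiv ℝ v x) :=
    integral_nonneg fun x => FluidPDE.frobeniusNormSq_nonneg _
  nlinarith [hsl, hlin, hG0, mul_nonneg hC₀0 hN0]

end Slice

/-! ### The cubic enstrophy inequality with dissipation on a slab -/

section Slab
set_option maxHeartbeats 400000 in -- buildfix (bf3-g26): 160k/180k FAIL, 200k PASS at accept time; line-neutral budget line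
/-- **The enstrophy inequality with dissipation, integrated in time** (Robinson–Rodrigo–Sadowski
2016, (6.7): `d/dt ‖∇u‖² + ‖Au‖² ≤ c‖∇u‖⁶`, whole space, viscosity `ν`). There is an absolute
constant `κ > 0` such that for every classical solution `(u, p)` of the unforced Navier–Stokes
system on a closed slab `[0, T] × ℝ³` in the smooth `H¹` class (`u, ∂ₜu, p ∈ L^∞_t H^k_x` for all
`k`), with `G(t) = ∫ |∇u(t)|²`: `G` is continuous on `[0, T]`,
`G(b) ≤ G(0) + κ ν⁻³ ∫₀ᵇ G³` for every `b ∈ [0, T]`,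
`ν ∫₀ᵀ ∫ ‖Δu‖² ≤ G(0) + κ ν⁻³ ∫₀ᵀ G³` (lower integral in time), and (bookkeeping) `G(t)` is the
lower integral `∫⁻ |∇u(t)|²` for `t ∈ [0, T]`.
Proof: the enstrophy balance `G(b) = G(0) + ∫₀ᵇ 2Σᵢ∫⟪∂ᵢu, ∂ᵢ∂ₜu⟫`
(`IsSmoothSpaceTimeOn.enstrophy_balance`), the dissipative slice bound
`exists_slice_dissipative` at each time, and the Sobolev inequality `‖u‖_{L⁶} ≤ K ‖Du‖_{L²}`
(`eLpNorm_six_le_eLpNorm_fderiv_two`), `‖Du‖²_{L²} ≤ ∫|∇u|²`. [cite: RobinsonRodrigoSadowski2016, Thm. 6.8 (proof, (6.7))] -/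
theorem exists_enstrophy_cubic_ineq :
    ∃ κ : ℝ, 0 < κ ∧ ∀ ⦃ν T : ℝ⦄ (_ : 0 < ν) (_ : 0 < T)
      ⦃u : ℝ → EuclideanSpace ℝ (Fin 3) → EuclideanSpace ℝ (Fin 3)⦄
      ⦃p : ℝ → EuclideanSpace ℝ (Fin 3) → ℝ⦄
      (_ : FluidPDE.IsClassicalNSSolutionOn (Icc 0 T) ν 0 u p)
      (_ : HasBoundedSobolevNormsOn (Icc 0 T) u)
      (_ : HasBoundedSobolevNormsOn (Icc 0 T) (FluidPDE.timeDerivWithin (Icc 0 T) u))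
      (_ : ∀ n : ℕ, ∃ C : ℝ≥0, ∀ t ∈ Icc 0 T, ∫⁻ x, ‖iteratedFDeriv ℝ n (p t) x‖ₑ ^ 2 ≤ C),
      ContinuousOn (fun t => ∫ x, FluidPDE.frobeniusNormSq (fderiv ℝ (u t) x)) (Icc 0 T) ∧
      (∀ b ∈ Icc 0 T, ∫ x, FluidPDE.frobeniusNormSq (fderiv ℝ (u b) x) ≤
        (∫ x, FluidPDE.frobeniusNormSq (fderiv ℝ (u 0) x)) +
          κ * (ν ^ 3)⁻¹ * ∫ t in (0 : ℝ)..b, (∫ x, FluidPDE.frobeniusNormSq (fderiv ℝ (u t) x)) ^ 3) ∧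
      ENNReal.ofReal ν * ∫⁻ t in Ioo 0 T, ∫⁻ x, ‖(Δ (u t)) x‖ₑ ^ 2 ≤
        ENNReal.ofReal ((∫ x, FluidPDE.frobeniusNormSq (fderiv ℝ (u 0) x)) +
          κ * (ν ^ 3)⁻¹ * ∫ t in (0 : ℝ)..T, (∫ x, FluidPDE.frobeniusNormSq (fderiv ℝ (u t) x)) ^ 3) ∧
      (∀ t ∈ Icc 0 T, ENNReal.ofReal (∫ x, FluidPDE.frobeniusNormSq (fderiv ℝ (u t) x)) =
        ∫⁻ x, ENNReal.ofReal (FluidPDE.frobeniusNormSq (fderiv ℝ (u t) x))) := by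
  obtain ⟨C, hC0, hslice⟩ := exists_slice_dissipative
  set K : ℝ≥0 := SNormLESNormFDerivOfEqConst (EuclideanSpace ℝ (Fin 3))
    (volume : Measure (EuclideanSpace ℝ (Fin 3))) 2 with hK
  refine ⟨2 * C * (K : ℝ) ^ 4 + 1, by positivity, ?_⟩
  intro ν T hν hT u p hsol hu hut hp
  set κ : ℝ := 2 * C * (K : ℝ) ^ 4 + 1 with hκ
  have hκ0 : 0 < κ := by positivity
  have hν3 : 0 < (ν ^ 3)⁻¹ := by positivity
  set e := EuclideanSpace.basisFun (Fin 3) ℝ with he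
  have hU : UniqueDiffOn ℝ (Icc 0 T) := uniqueDiffOn_Icc hT
  set W : ℝ → EuclideanSpace ℝ (Fin 3) → EuclideanSpace ℝ (Fin 3) :=
    FluidPDE.timeDerivWithin (Icc 0 T) u with hW
  have hWsm : FluidPDE.IsSmoothSpaceTimeOn (Icc 0 T) W := hsol.smooth_velocity.timeDerivWithin hU
  -- bounds of the class
  obtain ⟨B₀, hB₀⟩ := linfty_bound_of_hasBoundedSobolevNormsOn_holds
    (fun t ht => (hsol.contDiff_velocity ht).of_le (by norm_cast)) hu
  obtain ⟨C₀, hC₀⟩ := hu 0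
  obtain ⟨C₁, hC₁⟩ := hu 1
  obtain ⟨D₂, hD₂⟩ := hu 2
  obtain ⟨D₃, hD₃⟩ := hu 3
  obtain ⟨E₀, hE₀⟩ := hut 0
  obtain ⟨E₁, hE₁⟩ := hut 1
  obtain ⟨P₀, hP₀⟩ := hp 0
  obtain ⟨P₁, hP₁⟩ := hp 1
  have hzero : ∀ {f : EuclideanSpace ℝ (Fin 3) → EuclideanSpace ℝ (Fin 3)} {C' : ℝ≥0},
      (∫⁻ x, ‖iteratedFDeriv ℝ 0 f x‖ₑ ^ 2 ≤ C') → ∫⁻ x, ‖f x‖ₑ ^ 2 < ⊤ := by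
    intro f C' h
    refine lt_of_le_of_lt ((le_of_eq (lintegral_congr fun x => ?_)).trans h) ENNReal.coe_lt_top
    rw [← ofReal_norm, ← ofReal_norm, norm_iteratedFDeriv_zero]
  have hzero' : ∀ {f : EuclideanSpace ℝ (Fin 3) → ℝ} {C' : ℝ≥0},
      (∫⁻ x, ‖iteratedFDeriv ℝ 0 f x‖ₑ ^ 2 ≤ C') → ∫⁻ x, ‖f x‖ₑ ^ 2 < ⊤ := by
    intro f C' h
    refine lt_of_le_of_lt ((le_of_eq (lintegral_congr fun x => ?_)).trans h) ENNReal.coe_lt_top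
    rw [← ofReal_norm, ← ofReal_norm, norm_iteratedFDeriv_zero]
  have hB₀0 : 0 ≤ B₀ := (norm_nonneg _).trans (hB₀ 0 ⟨le_rfl, hT.le⟩ 0)
  have hL2 : ∀ t ∈ Icc 0 T, eLpNorm (u t) 2 volume < ⊤ := fun t ht =>
    eLpNorm_two_lt_top_of_lintegral_enorm_sq_lt_top (hzero (hC₀ t ht))
  have hL6 : ∀ t ∈ Icc 0 T, eLpNorm (u t) 6 volume < ⊤ := fun t ht =>
    eLpNorm_lt_top_of_bound_of_two hB₀0 (hB₀ t ht) (hzero (hC₀ t ht)) (by norm_num)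
  -- the enstrophy balance; the functions `Φ`, `G`, `D` (kept opaque, with defining equations)
  obtain ⟨hΦint, hGcont, hGb⟩ := hsol.smooth_velocity.enstrophy_balance hT hC₁ hE₁
  obtain ⟨Φ, hΦ⟩ : ∃ Φ : ℝ → ℝ,
      Φ = fun t => ∫ x, 2 * ∑ i, ⟪fderiv ℝ (u t) x (e i), fderiv ℝ (W t) x (e i)⟫ := ⟨_, rfl⟩
  obtain ⟨G, hG⟩ : ∃ G : ℝ → ℝ,
      G = fun t => ∫ x, FluidPDE.frobeniusNormSq (fderiv ℝ (u t) x) := ⟨_, rfl⟩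
  obtain ⟨D, hD⟩ : ∃ D : ℝ → ℝ, D = fun t => ∫ x, ‖(Δ (u t)) x‖ ^ 2 := ⟨_, rfl⟩
  have hΦt : ∀ t, Φ t = ∫ x, 2 * ∑ i, ⟪fderiv ℝ (u t) x (e i), fderiv ℝ (W t) x (e i)⟫ :=
    fun t => by rw [hΦ]
  have hGt : ∀ t, G t = ∫ x, FluidPDE.frobeniusNormSq (fderiv ℝ (u t) x) := fun t => by rw [hG]
  have hDt : ∀ t, D t = ∫ x, ‖(Δ (u t)) x‖ ^ 2 := fun t => by rw [hD]
  rw [← hΦ] at hΦint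
  have hGcont0 := hGcont
  rw [← hG] at hGcont
  have hGb' : ∀ b ∈ Ioc 0 T, G b = G 0 + ∫ t in (0 : ℝ)..b, Φ t := by
    intro b hb
    rw [hGt, hGt, hΦ]
    exact hGb b hb
  have hG0 : ∀ t, 0 ≤ G t := fun t => by
    rw [hGt]; exact integral_nonneg fun x => FluidPDE.frobeniusNormSq_nonneg _
  have hD0 : ∀ t, 0 ≤ D t := fun t => by
    rw [hDt]; exact integral_nonneg fun x => sq_nonneg _
  -- per-slice quantities
  have hDv_eq : ∀ t x, ‖fderiv ℝ (u t) x‖ = ‖iteratedFDeriv ℝ 1 (u t) x‖ := fun t x => by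
    rw [← norm_iteratedFDeriv_fderiv, norm_iteratedFDeriv_zero]
  have l2Dv : ∀ t ∈ Icc 0 T, ∫⁻ x, ‖fderiv ℝ (u t) x‖ₑ ^ 2 < ⊤ := fun t ht =>
    lintegral_enorm_sq_lt_top_of_norm_le (fun x => (hDv_eq t x).le) ((hC₁ t ht).trans_lt ENNReal.coe_lt_top)
  have ifrob : ∀ t ∈ Icc 0 T, Integrable (fun x => FluidPDE.frobeniusNormSq (fderiv ℝ (u t) x)) volume := by
    intro t ht
    have hlt : ∫⁻ x, ENNReal.ofReal (FluidPDE.frobeniusNormSq (fderiv ℝ (u t) x)) < ⊤ :=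
      calc ∫⁻ x, ENNReal.ofReal (FluidPDE.frobeniusNormSq (fderiv ℝ (u t) x))
          ≤ ∫⁻ x, 3 * ‖fderiv ℝ (u t) x‖ₑ ^ 2 :=
            lintegral_mono fun x => ofReal_frobeniusNormSq_le_three_mul_enorm_sq _
        _ = 3 * ∫⁻ x, ‖fderiv ℝ (u t) x‖ₑ ^ 2 := lintegral_const_mul' _ _ (by norm_num)
        _ < ⊤ := ENNReal.mul_lt_top (by norm_num) (l2Dv t ht)
    exact integrable_of_continuous_of_nonneg
      (FluidPDE.continuous_frobeniusNormSq_fderiv (hsol.contDiff_velocity ht) (by simp))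
      (fun x => FluidPDE.frobeniusNormSq_nonneg _) hlt
  have iDv : ∀ t ∈ Icc 0 T, Integrable (fun x => ‖fderiv ℝ (u t) x‖ ^ 2) volume := fun t ht =>
    FluidPDE.integrable_sq_norm_of_lintegral_lt_top
      ((hsol.contDiff_velocity ht).continuous_fderiv (by simp)) (l2Dv t ht)
  have n_Δ : ∀ t ∈ Icc 0 T, ∀ x, ‖(Δ (u t)) x‖ ≤ ‖(3 : ℝ) • iteratedFDeriv ℝ 2 (u t) x‖ := by
    intro t ht x
    rw [norm_smul, Real.norm_of_nonneg (by norm_num : (0 : ℝ) ≤ 3)]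
    exact norm_laplacian_le_three_mul_norm_iteratedFDeriv_two
      ((hsol.contDiff_velocity ht).of_le (by norm_cast)) x
  have l2Δ : ∀ t ∈ Icc 0 T, ∫⁻ x, ‖(Δ (u t)) x‖ₑ ^ 2 < ⊤ := fun t ht =>
    lintegral_enorm_sq_lt_top_of_norm_le (n_Δ t ht)
      (lintegral_enorm_sq_const_smul_lt_top 3 ((hD₂ t ht).trans_lt ENNReal.coe_lt_top))
  have cΔ : ∀ t ∈ Icc 0 T, Continuous (Δ (u t)) := fun t ht =>
    (contDiff_one_laplacian_of_contDiff_three ((hsol.contDiff_velocity ht).of_le (by norm_cast))).continuous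
  have iΔΔ : ∀ t ∈ Icc 0 T, Integrable (fun x => ‖(Δ (u t)) x‖ ^ 2) volume := fun t ht =>
    FluidPDE.integrable_sq_norm_of_lintegral_lt_top (cΔ t ht) (l2Δ t ht)
  -- Sobolev: `‖u(t)‖⁴_{L⁶} ≤ K⁴ G(t)²`
  have hSob : ∀ t ∈ Icc 0 T, (eLpNorm (u t) 6 volume).toReal ^ 4 ≤ (K : ℝ) ^ 4 * G t ^ 2 := by
    intro t ht
    set M : ℝ≥0∞ := eLpNorm (fderiv ℝ (u t)) 2 volume with hM
    have hMtop : M < ⊤ := eLpNorm_two_lt_top_of_lintegral_enorm_sq_lt_top (l2Dv t ht)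
    have hS : eLpNorm (u t) 6 volume ≤ K * M :=
      eLpNorm_six_le_eLpNorm_fderiv_two volume finrank_euclideanSpace_fin
        ((hsol.contDiff_velocity ht).of_le (by norm_cast)) (hL2 t ht)
    have hN : (eLpNorm (u t) 6 volume).toReal ≤ (K : ℝ) * M.toReal := by
      have h := ENNReal.toReal_mono (ENNReal.mul_ne_top ENNReal.coe_ne_top hMtop.ne) hS
      rwa [ENNReal.toReal_mul, ENNReal.coe_toReal] at h
    have hM2 : M.toReal ^ 2 ≤ G t := by
      have h1 : M.toReal ^ 2 = ∫ x, ‖fderiv ℝ (u t) x‖ ^ 2 := by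
        rw [← ENNReal.toReal_pow, hM, ← lintegral_enorm_sq_eq_eLpNorm_two_sq,
          ← ofReal_integral_sq_norm (iDv t ht), ENNReal.toReal_ofReal (integral_nonneg fun _ => sq_nonneg _)]
      rw [h1, hGt]
      exact integral_mono (iDv t ht) (ifrob t ht) fun x => FluidPDE.sq_opNorm_le_frobeniusNormSq _
    have hN0 : 0 ≤ (eLpNorm (u t) 6 volume).toReal := ENNReal.toReal_nonneg
    have hMr0 : 0 ≤ M.toReal := ENNReal.toReal_nonneg
    calc (eLpNorm (u t) 6 volume).toReal ^ 4 ≤ ((K : ℝ) * M.toReal) ^ 4 :=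
          pow_le_pow_left₀ hN0 hN 4
      _ = (K : ℝ) ^ 4 * (M.toReal ^ 2) ^ 2 := by ring
      _ ≤ (K : ℝ) ^ 4 * G t ^ 2 := by
          gcongr
  -- the production bound at each time of the slab
  have hslab : ∀ t ∈ Icc 0 T, Φ t ≤ -ν * D t + κ * (ν ^ 3)⁻¹ * G t ^ 3 := by
    intro t ht
    have hmom : ∀ x, W t x + FluidPDE.convect (u t) (u t) x = ν • (Δ (u t)) x - gradient (p t) x := by
      intro x
      have h := hsol.momentum t ht x
      simpa [hW] using h
    have hsl := hslice hν ((hsol.contDiff_velocity ht).of_le (by norm_cast))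
      ((hWsm.contDiff_slice ht).of_le (by norm_cast))
      ((hsol.contDiff_pressure ht).of_le (by norm_cast)) hmom (hsol.divFree t ht)
      (fun x => hB₀ t ht x) (hL6 t ht)
      ((hC₁ t ht).trans_lt ENNReal.coe_lt_top) ((hD₂ t ht).trans_lt ENNReal.coe_lt_top)
      ((hD₃ t ht).trans_lt ENNReal.coe_lt_top)
      (hzero (hE₀ t ht)) ((hE₁ t ht).trans_lt ENNReal.coe_lt_top)
      (hzero' (hP₀ t ht)) ((hP₁ t ht).trans_lt ENNReal.coe_lt_top)
    have h2 : Φ t = 2 * ∫ x, ∑ i, ⟪fderiv ℝ (u t) x (e i), fderiv ℝ (W t) x (e i)⟫ := by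
      rw [hΦt]
      exact integral_const_mul _ _
    have hN4 := hSob t ht
    have hGnn := hG0 t
    have hprod : C * (ν ^ 3)⁻¹ * (eLpNorm (u t) 6 volume).toReal ^ 4 * G t ≤
        C * (ν ^ 3)⁻¹ * ((K : ℝ) ^ 4 * G t ^ 2) * G t := by
      gcongr
    have hextra : 0 ≤ (ν ^ 3)⁻¹ * G t ^ 3 := mul_nonneg hν3.le (pow_nonneg hGnn 3)
    rw [← hGt t, ← hDt t] at hsl
    rw [h2, hκ]
    nlinarith [hsl, hprod, hextra]
  refine ⟨hGcont0, ?_, ?_, fun t ht => ofReal_integral_eq_lintegral_ofReal (ifrob t ht)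
    (Eventually.of_forall fun x => FluidPDE.frobeniusNormSq_nonneg _)⟩
  · -- the cubic inequality `G(b) ≤ G(0) + κ ν⁻³ ∫₀ᵇ G³`
    simp only [← hGt]
    intro b hb
    rcases eq_or_lt_of_le hb.1 with hb0 | hb0
    · rw [← hb0, intervalIntegral.integral_same, mul_zero, add_zero]
    have hΦii : IntervalIntegrable Φ volume 0 b :=
      (intervalIntegrable_iff_integrableOn_Ioo_of_le hb0.le).2
        (hΦint.mono_set (Ioo_subset_Ioo le_rfl hb.2))
    have hgc : ContinuousOn (fun t => κ * (ν ^ 3)⁻¹ * G t ^ 3) (Icc 0 b) :=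
      continuousOn_const.mul ((hGcont.mono (Icc_subset_Icc le_rfl hb.2)).pow 3)
    have hgii : IntervalIntegrable (fun t => κ * (ν ^ 3)⁻¹ * G t ^ 3) volume 0 b :=
      hgc.intervalIntegrable_of_Icc hb0.le
    have hmono : ∫ t in (0 : ℝ)..b, Φ t ≤ ∫ t in (0 : ℝ)..b, κ * (ν ^ 3)⁻¹ * G t ^ 3 := by
      refine intervalIntegral.integral_mono_on hb0.le hΦii hgii fun t ht => ?_
      have h := hslab t ⟨ht.1, ht.2.trans hb.2⟩
      have hνD : 0 ≤ ν * D t := mul_nonneg hν.le (hD0 t)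
      linarith
    rw [hGb' b ⟨hb0, hb.2⟩]
    rw [intervalIntegral.integral_const_mul] at hmono
    linarith
  · -- the dissipation bound (lower integral in time)
    simp only [← hGt]
    obtain ⟨g, hg⟩ : ∃ g : ℝ → ℝ, g = fun t => κ * (ν ^ 3)⁻¹ * G t ^ 3 - Φ t := ⟨_, rfl⟩
    have hpt : ∀ t ∈ Ioo 0 T,
        ENNReal.ofReal ν * ∫⁻ x, ‖(Δ (u t)) x‖ₑ ^ 2 ≤ ENNReal.ofReal (g t) := by
      intro t ht
      have htI : t ∈ Icc 0 T := Ioo_subset_Icc_self ht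
      rw [← ofReal_integral_sq_norm (iΔΔ t htI), ← ENNReal.ofReal_mul hν.le, ← hDt]
      refine ENNReal.ofReal_le_ofReal ?_
      have h := hslab t htI
      rw [hg]
      linarith
    have hgnn : ∀ t ∈ Ioo 0 T, 0 ≤ g t := fun t ht => by
      have h := hslab t (Ioo_subset_Icc_self ht)
      have hνD : 0 ≤ ν * D t := mul_nonneg hν.le (hD0 t)
      rw [hg]
      linarith
    have hG3int : IntegrableOn (fun t => κ * (ν ^ 3)⁻¹ * G t ^ 3) (Ioo 0 T) volume :=
      ((continuousOn_const.mul (hGcont.pow 3)).integrableOn_compact isCompact_Icc).mono_set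
        Ioo_subset_Icc_self
    have hgint : IntegrableOn g (Ioo 0 T) volume := by rw [hg]; exact hG3int.sub hΦint
    have hg_ae : 0 ≤ᵐ[volume.restrict (Ioo 0 T)] g :=
      (ae_restrict_iff' measurableSet_Ioo).2 (Eventually.of_forall fun t ht => hgnn t ht)
    -- `∫_{(0,T)} Φ = G T - G 0`
    have hΦT : ∫ t in Ioo 0 T, Φ t = G T - G 0 := by
      have h := hGb' T ⟨hT, le_rfl⟩
      rw [intervalIntegral.integral_of_le hT.le, integral_Ioc_eq_integral_Ioo] at h
      rw [h]
      ring
    have hG3T : ∫ t in Ioo 0 T, κ * (ν ^ 3)⁻¹ * G t ^ 3 =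
        κ * (ν ^ 3)⁻¹ * ∫ t in (0 : ℝ)..T, G t ^ 3 := by
      rw [intervalIntegral.integral_of_le hT.le, integral_Ioc_eq_integral_Ioo, integral_const_mul]
    have hstep1 : ENNReal.ofReal ν * ∫⁻ t in Ioo 0 T, ∫⁻ x, ‖(Δ (u t)) x‖ₑ ^ 2 ≤
        ∫⁻ t in Ioo 0 T, ENNReal.ofReal (g t) := by
      rw [← lintegral_const_mul' _ _ ENNReal.ofReal_ne_top]
      exact setLIntegral_mono' measurableSet_Ioo hpt
    have hstep2 : ∫⁻ t in Ioo 0 T, ENNReal.ofReal (g t) = ENNReal.ofReal (∫ t in Ioo 0 T, g t) :=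
      (ofReal_integral_eq_lintegral_ofReal hgint hg_ae).symm
    have hstep3 : ∫ t in Ioo 0 T, g t ≤ G 0 + κ * (ν ^ 3)⁻¹ * ∫ t in (0 : ℝ)..T, G t ^ 3 := by
      rw [hg, integral_sub hG3int hΦint, hΦT, hG3T]
      linarith [hG0 T]
    exact hstep1.trans (hstep2.le.trans (ENNReal.ofReal_le_ofReal hstep3))

end Slab

/-! ### `∫ ‖D²v‖² ≤ 27 ∫ ‖Δv‖²` -/

section Hessian

/-- The second coordinate tensor is the sum of the squared mixed partials of the field:
`|∇²v(x)|² = Σⱼ Σᵢ ‖∂ᵢ∂ⱼ v(x)‖²` (`levelSq 2` of `CoordDerivatives.lean` versus the vector slices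
`∂ᵢ∂ⱼv = D(Dv · eⱼ) · eᵢ`). [folklore] -/
theorem levelSq_two_eq_sum_sum {v : EuclideanSpace ℝ (Fin 3) → EuclideanSpace ℝ (Fin 3)}
    (hv : ContDiff ℝ ∞ v) (x : EuclideanSpace ℝ (Fin 3)) :
    levelSq 2 v x = ∑ j, ∑ i, ‖fderiv ℝ (fun y => fderiv ℝ v y (EuclideanSpace.basisFun (Fin 3) ℝ j)) x
      (EuclideanSpace.basisFun (Fin 3) ℝ i)‖ ^ 2 := by
  have hvd : Differentiable ℝ v := hv.differentiable (by simp)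
  have hv2 : ContDiff ℝ 2 v := hv.of_le (by norm_cast)
  have hslice : ∀ j, Differentiable ℝ (fun y => fderiv ℝ v y (EuclideanSpace.basisFun (Fin 3) ℝ j)) :=
    fun j => ((hv2.fderiv_right (m := 1) (by norm_num)).clm_apply contDiff_const).differentiable
      one_ne_zero
  rw [show levelSq 2 v x = levelSq (1 + 1) v x from rfl, levelSq_succ_eq]
  refine Fintype.sum_equiv (Equiv.funUnique (Fin 1) (Fin 3)) _ _ fun β => ?_
  simp only [Equiv.funUnique_apply, Fin.default_eq_zero, ipderiv_succ, ipderiv_zero]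
  refine Finset.sum_congr rfl fun k _ => ?_
  rw [EuclideanSpace.real_norm_sq_eq]
  refine Finset.sum_congr rfl fun i _ => ?_
  congr 1
  -- `∂ₖ ∂_{β 0} vᵢ (x) = (D(Dv · e_{β 0})(x) eₖ)ᵢ`
  have hcomp : (fun y => fderiv ℝ v y (EuclideanSpace.basisFun (Fin 3) ℝ (β 0)) i) =
      fun y => fderiv ℝ (fun z => v z i) y (EuclideanSpace.basisFun (Fin 3) ℝ (β 0)) :=
    funext fun y => euclidean_fderiv_apply_comp (hvd y) _ i
  rw [euclidean_fderiv_apply_comp (hslice (β 0) x), hcomp, pderiv_apply, pderiv_eq,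
    stdVec_eq_basisFun, stdVec_eq_basisFun]

/-- **`∫ ‖D²v‖² ≤ 27 ∫ ‖Δv‖²`** for a smooth field on `ℝ³` with `Dv, D²v, D³v ∈ L²`: the operator
norm of `D²v(x)` is at most `3^{3/2}` times the coordinate tensor norm
(`lintegral_sq_norm_iteratedFDeriv_le`), and `Σⱼ Σᵢ ‖∂ᵢ∂ⱼv‖²_{L²} = ‖Δv‖²_{L²}` (the
Hessian–Laplacian identity `sum_sum_integral_sq_norm_fderiv_fderiv_eq_integral_sq_norm_laplacian`;
Stein 1970, Ch. III §1.3). [folklore] -/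
theorem lintegral_iteratedFDeriv_two_le_laplacian
    {v : EuclideanSpace ℝ (Fin 3) → EuclideanSpace ℝ (Fin 3)} (hv : ContDiff ℝ ∞ v)
    (hv1 : ∫⁻ x, ‖iteratedFDeriv ℝ 1 v x‖ₑ ^ 2 < ⊤) (hv2 : ∫⁻ x, ‖iteratedFDeriv ℝ 2 v x‖ₑ ^ 2 < ⊤)
    (hv3 : ∫⁻ x, ‖iteratedFDeriv ℝ 3 v x‖ₑ ^ 2 < ⊤) :
    ∫⁻ x, ‖iteratedFDeriv ℝ 2 v x‖ₑ ^ 2 ≤ 27 * ∫⁻ x, ‖(Δ v) x‖ₑ ^ 2 := by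
  set e := EuclideanSpace.basisFun (Fin 3) ℝ with he
  have hv3' : ContDiff ℝ 3 v := hv.of_le (by norm_cast)
  have hv2' : ContDiff ℝ 2 v := hv.of_le (by norm_cast)
  obtain ⟨hint, -⟩ := integrable_levelSq_of_lintegral_lt_top hv 2 hv2
  have h1 := lintegral_sq_norm_iteratedFDeriv_le hv 2 hint
  -- `∫ levelSq 2 v = Σⱼ Σᵢ ∫ ‖∂ᵢ∂ⱼ v‖² = ∫ ‖Δv‖²`
  have cdvs : ∀ j i, Continuous fun x => fderiv ℝ (fun y => fderiv ℝ v y (e j)) x (e i) := fun j i =>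
    ((((hv3'.fderiv_right (m := 2) (by norm_num)).clm_apply contDiff_const).continuous_fderiv
      (by norm_num)).clm_apply continuous_const)
  have i_dd : ∀ j i, Integrable (fun x => ‖fderiv ℝ (fun y => fderiv ℝ v y (e j)) x (e i)‖ ^ 2)
      volume := fun j i =>
    FluidPDE.integrable_sq_norm_of_lintegral_lt_top (cdvs j i)
      (lintegral_enorm_sq_lt_top_of_norm_le (fun x =>
        (norm_fderiv_apply_basisFun_le (fun y => fderiv ℝ v y (e j)) x i).trans
          (norm_iteratedFDeriv_fderiv_apply_basisFun_le hv3' 1 (by norm_num) x j)) hv2)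
  have hI : ∫ x, levelSq 2 v x = ∫ x, ‖(Δ v) x‖ ^ 2 := by
    rw [← sum_sum_integral_sq_norm_fderiv_fderiv_eq_integral_sq_norm_laplacian hv3' hv1 hv2 hv3,
      integral_congr_ae (Eventually.of_forall fun x => levelSq_two_eq_sum_sum hv x),
      integral_finsetSum _ fun j _ => integrable_finsetSum _ fun i _ => i_dd j i]
    exact Finset.sum_congr rfl fun j _ => integral_finsetSum _ fun i _ => i_dd j i
  -- `∫⁻ ‖Δv‖ₑ² = ofReal ∫ ‖Δv‖²`
  have cΔ : Continuous (Δ v) := (contDiff_one_laplacian_of_contDiff_three hv3').continuous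
  have n_Δ : ∀ x, ‖(Δ v) x‖ ≤ ‖(3 : ℝ) • iteratedFDeriv ℝ 2 v x‖ := fun x => by
    rw [norm_smul, Real.norm_of_nonneg (by norm_num : (0 : ℝ) ≤ 3)]
    exact norm_laplacian_le_three_mul_norm_iteratedFDeriv_two hv2' x
  have l2Δ : ∫⁻ x, ‖(Δ v) x‖ₑ ^ 2 < ⊤ :=
    lintegral_enorm_sq_lt_top_of_norm_le n_Δ (lintegral_enorm_sq_const_smul_lt_top 3 hv2)
  have iΔΔ : Integrable (fun x => ‖(Δ v) x‖ ^ 2) volume :=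
    FluidPDE.integrable_sq_norm_of_lintegral_lt_top cΔ l2Δ
  refine h1.trans (le_of_eq ?_)
  rw [hI, ENNReal.ofReal_mul (by norm_num), ofReal_integral_sq_norm iΔΔ]
  norm_num

end Hessian

/-! ### The continuity argument and the a priori bound -/

section Bootstrap

/-- **Continuity method for the cubic inequality** `G(b) ≤ G(0) + L ∫₀ᵇ G³` (Robinson–Rodrigo–
Sadowski 2016, (6.8)–(6.9): comparison with `X' = cX³`). If `G ≥ 0` is continuous on `[0, T]`,
`L > 0`, `B > 0` and `exp(L B² T) G(0) < B`, then `G(t) ≤ exp(L B² T) G(0)` on `[0, T]`: under the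
bootstrap hypothesis `G ≤ B` on `[0, t]` the inequality is linear with rate `L B²`, and the tree's
`bootstrap_gronwall_integral` applies. [folklore] -/
theorem cubic_bootstrap {T L B : ℝ} (hT : 0 < T) (hL : 0 < L) (hB : 0 < B) {G : ℝ → ℝ}
    (hGc : ContinuousOn G (Icc 0 T)) (hG0 : ∀ t, 0 ≤ G t)
    (hineq : ∀ b ∈ Icc 0 T, G b ≤ G 0 + L * ∫ t in (0 : ℝ)..b, G t ^ 3)
    (hM : Real.exp (L * B ^ 2 * T) * G 0 < B) :
    ∀ t ∈ Icc 0 T, G t ≤ Real.exp (L * B ^ 2 * T) * G 0 := by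
  have hB2 : 0 < L * B ^ 2 := by positivity
  have h := bootstrap_gronwall_integral (κ := L * B ^ 2) (B := B) (W := G) (g := fun _ => 0) hT
    hB2 hGc continuousOn_const (fun _ _ => le_rfl) (hG0 0) ?_ (by simpa using hM)
  · simpa using h
  intro t ht hboot
  have hGc' : ContinuousOn G (Icc 0 t) := hGc.mono (Icc_subset_Icc le_rfl ht.2)
  have hmono : ∫ s in (0 : ℝ)..t, G s ^ 3 ≤ ∫ s in (0 : ℝ)..t, B ^ 2 * G s := by
    refine intervalIntegral.integral_mono_on ht.1 ((hGc'.pow 3).intervalIntegrable_of_Icc ht.1)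
      ((continuousOn_const.mul hGc').intervalIntegrable_of_Icc ht.1) fun s hs => ?_
    have hGs := hG0 s
    have hsB := hboot s hs
    have h2 : G s ^ 2 ≤ B ^ 2 := pow_le_pow_left₀ hGs hsB 2
    calc G s ^ 3 = G s ^ 2 * G s := by ring
      _ ≤ B ^ 2 * G s := mul_le_mul_of_nonneg_right h2 hGs
  calc G t ≤ G 0 + L * ∫ s in (0 : ℝ)..t, G s ^ 3 := hineq t ht
    _ ≤ G 0 + L * ∫ s in (0 : ℝ)..t, B ^ 2 * G s := by gcongr
    _ = G 0 + ∫ s in (0 : ℝ)..t, (L * B ^ 2 * G s + 0) := by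
        rw [← intervalIntegral.integral_const_mul]
        congr 1
        refine intervalIntegral.integral_congr fun s _ => ?_
        show L * (B ^ 2 * G s) = L * B ^ 2 * G s + 0
        ring

/-- **The enstrophy a priori bound with lifespan, explicit constants** (Robinson–Rodrigo–Sadowski
2016, proof of Thm. 6.8, (6.6)–(6.10), Cor. 6.9; Tao 2011, Thm. 5.4 (ii)): there are absolute
constants `c, K > 0` such that for every classical solution `(u, p)` of the unforced Navier–Stokes
system on `[0, T] × ℝ³` in the smooth `H¹` class (`u, ∂ₜu, p ∈ L^∞_t H^k_x`), if
`∫|∇u(0)|² ≤ A` and `A² T ≤ c ν³` then `∫|∇u(t)|² ≤ K A` for all `t ∈ [0, T]` and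
`ν ∫₀ᵀ∫‖D²u‖² ≤ K A`. This is the statement `LerayEnstrophyAPrioriWith c K` of
`TaoH1APriori.lean` (here with `c = 1/(8κ)`, `K = 54`, `κ` the constant of
`exists_enstrophy_cubic_ineq`). [cite: RobinsonRodrigoSadowski2016, Thm. 6.8 (proof, (6.6)-(6.10)) and Cor. 6.9] -/
theorem exists_leray_enstrophy_apriori :
    ∃ c K : ℝ, 0 < c ∧ 0 < K ∧ ∀ ⦃ν T : ℝ⦄, 0 < ν → 0 < T →
      ∀ ⦃u : ℝ → EuclideanSpace ℝ (Fin 3) → EuclideanSpace ℝ (Fin 3)⦄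
        ⦃p : ℝ → EuclideanSpace ℝ (Fin 3) → ℝ⦄,
        FluidPDE.IsClassicalNSSolutionOn (Icc 0 T) ν 0 u p → HasBoundedSobolevNormsOn (Icc 0 T) u →
        HasBoundedSobolevNormsOn (Icc 0 T) (FluidPDE.timeDerivWithin (Icc 0 T) u) →
        (∀ n : ℕ, ∃ C : ℝ≥0, ∀ t ∈ Icc 0 T, ∫⁻ x, ‖iteratedFDeriv ℝ n (p t) x‖ₑ ^ 2 ≤ C) →
        ∀ ⦃A : ℝ⦄, 0 ≤ A →
          (∫⁻ x, ENNReal.ofReal (FluidPDE.frobeniusNormSq (fderiv ℝ (u 0) x))) ≤ ENNReal.ofReal A →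
          A ^ 2 * T ≤ c * ν ^ 3 →
          (∀ t ∈ Icc 0 T, (∫⁻ x, ENNReal.ofReal (FluidPDE.frobeniusNormSq (fderiv ℝ (u t) x))) ≤
              ENNReal.ofReal (K * A)) ∧
            ENNReal.ofReal ν * ∫⁻ t in Ioo 0 T, ∫⁻ x, ‖iteratedFDeriv ℝ 2 (u t) x‖ₑ ^ 2 ≤
              ENNReal.ofReal (K * A) := by
  obtain ⟨κ, hκ, hcubic⟩ := exists_enstrophy_cubic_ineq
  refine ⟨(8 * κ)⁻¹, 54, by positivity, by norm_num, ?_⟩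
  intro ν T hν hT u p hsol hu hut hp A hA0 h0 hsmall
  obtain ⟨hGc, hineq, hdiss, hGeq⟩ := hcubic hν hT hsol hu hut hp
  obtain ⟨G, hG⟩ : ∃ G : ℝ → ℝ,
      G = fun t => ∫ x, FluidPDE.frobeniusNormSq (fderiv ℝ (u t) x) := ⟨_, rfl⟩
  have hGt : ∀ t, G t = ∫ x, FluidPDE.frobeniusNormSq (fderiv ℝ (u t) x) := fun t => by rw [hG]
  rw [← hG] at hGc
  simp only [← hGt] at hineq hdiss hGeq
  set L : ℝ := κ * (ν ^ 3)⁻¹ with hL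
  have hL0 : 0 < L := by positivity
  have hG0 : ∀ t, 0 ≤ G t := fun t => by
    rw [hGt]; exact integral_nonneg fun x => FluidPDE.frobeniusNormSq_nonneg _
  -- `G 0 ≤ A`
  have hGA : G 0 ≤ A := by
    have h := h0
    rw [← hGeq 0 ⟨le_rfl, hT.le⟩] at h
    exact (ENNReal.ofReal_le_ofReal_iff hA0).1 h
  -- the smallness condition: `8 L A² T ≤ 1`
  have hsm : 8 * L * A ^ 2 * T ≤ 1 := by
    have hν3 : 0 < ν ^ 3 := by positivity
    calc 8 * L * A ^ 2 * T = (8 * κ / ν ^ 3) * (A ^ 2 * T) := by rw [hL]; ring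
      _ ≤ (8 * κ / ν ^ 3) * ((8 * κ)⁻¹ * ν ^ 3) :=
          mul_le_mul_of_nonneg_left hsmall (by positivity)
      _ = 1 := by field_simp
  -- the uniform bound `G ≤ 2A` on `[0, T]`
  have hsup : ∀ t ∈ Icc 0 T, G t ≤ 2 * A := by
    rcases eq_or_lt_of_le hA0 with hA | hA
    · -- `A = 0`: `G 0 = 0` and the bootstrap with `B = 1` gives `G ≡ 0`
      have hG00 : G 0 = 0 := le_antisymm (hGA.trans_eq hA.symm) (hG0 0)
      have h := cubic_bootstrap hT hL0 one_pos hGc hG0 hineq (by rw [hG00, mul_zero]; exact one_pos)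
      intro t ht
      have h1 := h t ht
      rw [hG00, mul_zero] at h1
      linarith
    · have h4 : L * (2 * A) ^ 2 * T ≤ 1 / 2 := by nlinarith [hsm]
      have hexp : Real.exp (L * (2 * A) ^ 2 * T) ≤ Real.exp (1 / 2) := Real.exp_le_exp.2 h4
      have he2 : Real.exp (1 / 2 : ℝ) < 2 := by
        have h1 : Real.exp (1 / 2 : ℝ) ^ 2 = Real.exp 1 := by
          rw [← Real.exp_nat_mul]; norm_num
        nlinarith [Real.exp_pos (1 / 2 : ℝ), Real.exp_one_lt_d9]
      have hM : Real.exp (L * (2 * A) ^ 2 * T) * G 0 < 2 * A :=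
        calc Real.exp (L * (2 * A) ^ 2 * T) * G 0 ≤ Real.exp (1 / 2) * A :=
              mul_le_mul hexp hGA (hG0 0) (Real.exp_pos _).le
          _ < 2 * A := by nlinarith [he2, hA]
      have h := cubic_bootstrap hT hL0 (by positivity : (0 : ℝ) < 2 * A) hGc hG0 hineq hM
      intro t ht
      calc G t ≤ Real.exp (L * (2 * A) ^ 2 * T) * G 0 := h t ht
        _ ≤ Real.exp (1 / 2) * A := mul_le_mul hexp hGA (hG0 0) (Real.exp_pos _).le
        _ ≤ 2 * A := by nlinarith [he2, hA]
  refine ⟨fun t ht => ?_, ?_⟩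
  · -- the enstrophy bound
    rw [← hGeq t ht]
    exact ENNReal.ofReal_le_ofReal (by nlinarith [hsup t ht, hA0])
  · -- the dissipation bound
    have hG3 : ∫ t in (0 : ℝ)..T, G t ^ 3 ≤ ∫ t in (0 : ℝ)..T, (2 * A) ^ 3 :=
      intervalIntegral.integral_mono_on hT.le ((hGc.pow 3).intervalIntegrable_of_Icc hT.le)
        intervalIntegrable_const fun t ht => pow_le_pow_left₀ (hG0 t) (hsup t ht) 3
    have hconst : ∫ t in (0 : ℝ)..T, (2 * A) ^ 3 = T * (2 * A) ^ 3 := by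
      rw [intervalIntegral.integral_const, sub_zero, smul_eq_mul]
    have hbound : G 0 + L * ∫ t in (0 : ℝ)..T, G t ^ 3 ≤ 2 * A := by
      have h1 : L * ∫ t in (0 : ℝ)..T, G t ^ 3 ≤ L * (T * (2 * A) ^ 3) :=
        mul_le_mul_of_nonneg_left (hG3.trans_eq hconst) hL0.le
      have h2 : L * (T * (2 * A) ^ 3) = (8 * L * A ^ 2 * T) * A := by ring
      nlinarith [hsm, hGA, hA0, h1, h2]
    obtain ⟨C₁, hC₁⟩ := hu 1
    obtain ⟨D₂, hD₂⟩ := hu 2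
    obtain ⟨D₃, hD₃⟩ := hu 3
    have hD2 : ∫⁻ t in Ioo 0 T, ∫⁻ x, ‖iteratedFDeriv ℝ 2 (u t) x‖ₑ ^ 2 ≤
        27 * ∫⁻ t in Ioo 0 T, ∫⁻ x, ‖(Δ (u t)) x‖ₑ ^ 2 := by
      rw [← lintegral_const_mul' _ _ (by norm_num)]
      refine setLIntegral_mono' measurableSet_Ioo fun t ht => ?_
      have htI : t ∈ Icc 0 T := Ioo_subset_Icc_self ht
      exact lintegral_iteratedFDeriv_two_le_laplacian (hsol.contDiff_velocity htI)
        ((hC₁ t htI).trans_lt ENNReal.coe_lt_top) ((hD₂ t htI).trans_lt ENNReal.coe_lt_top)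
        ((hD₃ t htI).trans_lt ENNReal.coe_lt_top)
    calc ENNReal.ofReal ν * ∫⁻ t in Ioo 0 T, ∫⁻ x, ‖iteratedFDeriv ℝ 2 (u t) x‖ₑ ^ 2
        ≤ ENNReal.ofReal ν * (27 * ∫⁻ t in Ioo 0 T, ∫⁻ x, ‖(Δ (u t)) x‖ₑ ^ 2) := by gcongr
      _ = 27 * (ENNReal.ofReal ν * ∫⁻ t in Ioo 0 T, ∫⁻ x, ‖(Δ (u t)) x‖ₑ ^ 2) := by ring
      _ ≤ 27 * ENNReal.ofReal (G 0 + L * ∫ t in (0 : ℝ)..T, G t ^ 3) := by gcongr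
      _ ≤ 27 * ENNReal.ofReal (2 * A) := by gcongr
      _ = ENNReal.ofReal (54 * A) := by
          rw [← ENNReal.ofReal_ofNat 27, ← ENNReal.ofReal_mul (by norm_num)]
          congr 1
          ring

end Bootstrap

end Literature.Analysis.FluidPDE

end
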